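import Literature.AlgebraicGeometry.Frobenioids.Thm34SubStdHyp
import Literature.AlgebraicGeometry.Frobenioids.PadicFrobenioidStandardType
import Literature.AlgebraicGeometry.Frobenioids.ModelFrobenioidTypeBridge
import Mathlib.CategoryTheory.PEmpty
import HarnessLib

/-!
# Frobenioids I, Theorem 3.4: the hypothesis bundles `FSMHyp`, `StdHyp` of `Thm34Sub` are SCHEMAS —
# universal closures refuted; instance forms at `p`-adic Frobenioids proved

Mochizuki, *The geometry of Frobenioids I: the general theory*, Kyushu J. Math. **62** (2008), Thm. 3.4
(ii)/(iii), kurims p. 62 [cite: MochizukiFrdI2008, Thm. 3.4 (iii) p.62]; *The geometry of Frobenioids II*,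
Kyushu J. Math. **62** (2008), Example 1.1 (ii) p. 8 and Theorem 1.2 (i) p. 9
[cite: MochizukiFrdII2008, Thm 1.2 (i) p.9].

PROOF-ONLY companion (no definitions, no instances) of abc-iut-L1-lead's statements file `Thm34Sub.lean`
(FACT-LIST rows **F-2691** `FrdI.Thm34Sub.FSMHyp` and **F-2692** `FrdI.Thm34Sub.StdHyp`, both
`structure … : Prop`, class `preparatory`, status `conditional`), abc-iut cell seat abc-iut-f-049.

`FSMHyp F₁ F₂` and `StdHyp F₁ F₂ Ψ` are HYPOTHESIS BUNDLES over arbitrary pre-Frobenioid structure functors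
`F_i : C_i → F_{Φ_i}` (and an arbitrary equivalence `Ψ : C₁ ≌ C₂`): they package the printed hypotheses
of Thm. 3.4 (iii)–(v) — "`C_i` Frobenioids (of quasi-isotropic / standard type) over FSM-type bases,
(a), (b)".  Nothing forces an arbitrary `F_i` to be a Frobenioid, so the universal closures are false:
already over the EMPTY category `C₁` the field `isFrobenioid₁` fails (a Frobenioid is connected, hence
nonempty, [FrdI] Def. 1.1 (iv) / §0 p. 16), as does `nonGroupLike₁`.  This file records

* `not_fsmHyp_of_isEmpty`, `not_stdHyp_of_isEmpty` — for EVERY `F₁` on an empty `C₁` and every `F₂`, `Ψ`;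
* `not_forall_fsmHyp`, `not_forall_stdHyp` — the fully quantified closures are false (witness: the empty
  structure functor over the one-point base with the trivial monoid);

and the INSTANCE FORMS the cone consumes ([IUTchI] Ex. 3.3 (iii), `GoodLocalFrobenioid.padicFrobenioid_stdHyp`,
is the self-equivalence case of `stdHyp_padic`): for `p`-adic Frobenioids ([FrdII] Ex. 1.1 (ii)) over bases of
FSM-type,

* `PadicFrd.Datum.not_isGroupLikeObj_zeroObj`, `PadicFrd.Datum.exists_not_isGroupLikeObj` — the object
  `(A_D, 0)` is not group-like (`Φ(A_D) ≠ 0`, [FrdII] Ex. 1.1 (ii) "the homomorphism `B(A) → Φ^gp(A)` is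
  nonzero");
* `FrdI.Thm34Sub.stdHyp_padic` — `StdHyp` for ANY equivalence between two `p`-adic Frobenioids over FSM-type
  bases ([FrdII] Thm. 1.2 (i): Frobenioids of standard type; (b) `HypB` vacuous, not of group-like type);
* `FrdI.Thm34Sub.fsmHyp_padic` — `FSMHyp` for two `p`-adic Frobenioids over FSM-type bases.

So F-2691/F-2692 are admissible AT NAMED INSTANCES ONLY (FACT-LIST class «universal-closure REFUTED / schema;
instance forms PROVED»).  Bookkeeping about the typing; nothing here bears on [IUTchIII] Cor. 3.12 or takes a
side; a refuted closure is a statement about the schema, not about the paper.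
-/

namespace Literature.AlgebraicGeometry.Frobenioids

open CategoryTheory Opposite PreFrobenioidData

universe w v v' u u'

/-! ### The closures are false: empty `C₁` -/

namespace FrdI.Thm34Sub

section Empty

variable {D₁ : Type u} [Category.{v} D₁] {Φ₁ : D₁ᵒᵖ ⥤ CommMonCat.{w}} {C₁ : Type u'} [Category.{v'} C₁]
  {D₂ : Type u} [Category.{v} D₂] {Φ₂ : D₂ᵒᵖ ⥤ CommMonCat.{w}} {C₂ : Type u'} [Category.{v'} C₂]
  (F₁ : C₁ ⥤ ElemFrobenioid Φ₁) (F₂ : C₂ ⥤ ElemFrobenioid Φ₂) (Ψ : C₁ ≌ C₂)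

/-- **F-2691 is a schema**: `FSMHyp F₁ F₂` FAILS whenever `C₁` is empty (its field `isFrobenioid₁` makes `C₁`
connected, hence nonempty; so does `nonGroupLike₁`), for every `F₂`. [cite: MochizukiFrdI2008, Thm. 3.4 (iii) p.62] -/
theorem not_fsmHyp_of_isEmpty [IsEmpty C₁] : ¬ FSMHyp F₁ F₂ := fun h =>
  h.isFrobenioid₁.isPreFrobenioid.isGraphConnected.nonempty.elim fun A => isEmptyElim A

/-- **F-2692 is a schema**: `StdHyp F₁ F₂ Ψ` FAILS whenever `C₁` is empty (its field `isFrobenioid₁` makes `C₁`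
connected, hence nonempty), for every `F₂`, `Ψ`. [cite: MochizukiFrdI2008, Thm. 3.4 (iii) p.62] -/
theorem not_stdHyp_of_isEmpty [IsEmpty C₁] : ¬ StdHyp F₁ F₂ Ψ := fun h =>
  h.isFrobenioid₁.isPreFrobenioid.isGraphConnected.nonempty.elim fun A => isEmptyElim A

end Empty

/-- **The universal closure of F-2691 is false** (witness: `C₁ = C₂ = ∅` over the one-point base `D` with the
trivial monoid `Φ = 1`); the printed statement is the instance at Frobenioids over FSM-type bases, e.g.
`fsmHyp_padic` below. [cite: MochizukiFrdI2008, Thm. 3.4 (iii) p.62] -/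
theorem not_forall_fsmHyp :
    ¬ ∀ (D₁ : Type) (_ : Category.{0} D₁) (Φ₁ : D₁ᵒᵖ ⥤ CommMonCat.{0}) (C₁ : Type) (_ : Category.{0} C₁)
        (D₂ : Type) (_ : Category.{0} D₂) (Φ₂ : D₂ᵒᵖ ⥤ CommMonCat.{0}) (C₂ : Type) (_ : Category.{0} C₂)
        (F₁ : C₁ ⥤ ElemFrobenioid Φ₁) (F₂ : C₂ ⥤ ElemFrobenioid Φ₂), FSMHyp F₁ F₂ := fun h =>
  not_fsmHyp_of_isEmpty
    (Φ₁ := (Functor.const _).obj (CommMonCat.of PUnit)) (Φ₂ := (Functor.const _).obj (CommMonCat.of PUnit))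
    (Functor.empty.{0} (ElemFrobenioid ((Functor.const (Discrete PUnit.{1})ᵒᵖ).obj (CommMonCat.of PUnit.{1}))))
    (Functor.empty.{0} (ElemFrobenioid ((Functor.const (Discrete PUnit.{1})ᵒᵖ).obj (CommMonCat.of PUnit.{1}))))
    (h _ _ _ _ _ _ _ _ _ _ _ _)

/-- **The universal closure of F-2692 is false** (same witness, `Ψ` the identity equivalence of the empty
category); the printed statement is the instance at Frobenioids of standard type over FSM-type bases, e.g.
`stdHyp_padic` below. [cite: MochizukiFrdI2008, Thm. 3.4 (iii) p.62] -/
theorem not_forall_stdHyp :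
    ¬ ∀ (D₁ : Type) (_ : Category.{0} D₁) (Φ₁ : D₁ᵒᵖ ⥤ CommMonCat.{0}) (C₁ : Type) (_ : Category.{0} C₁)
        (D₂ : Type) (_ : Category.{0} D₂) (Φ₂ : D₂ᵒᵖ ⥤ CommMonCat.{0}) (C₂ : Type) (_ : Category.{0} C₂)
        (F₁ : C₁ ⥤ ElemFrobenioid Φ₁) (F₂ : C₂ ⥤ ElemFrobenioid Φ₂) (Ψ : C₁ ≌ C₂), StdHyp F₁ F₂ Ψ := fun h =>
  not_stdHyp_of_isEmpty
    (Φ₁ := (Functor.const _).obj (CommMonCat.of PUnit)) (Φ₂ := (Functor.const _).obj (CommMonCat.of PUnit))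
    (Functor.empty.{0} (ElemFrobenioid ((Functor.const (Discrete PUnit.{1})ᵒᵖ).obj (CommMonCat.of PUnit.{1}))))
    (Functor.empty.{0} (ElemFrobenioid ((Functor.const (Discrete PUnit.{1})ᵒᵖ).obj (CommMonCat.of PUnit.{1}))))
    CategoryTheory.Equivalence.refl (h _ _ _ _ _ _ _ _ _ _ _ _ _)

end FrdI.Thm34Sub

/-! ### Instance forms at `p`-adic Frobenioids ([FrdII] Ex. 1.1 (ii), Thm. 1.2 (i)) -/

namespace PadicFrd.Datum

variable {D : Type u} [Category.{v} D] {p : ℕ} [Fact p.Prime] (d : Datum D p)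

/-- In a `p`-adic Frobenioid the object `(A_D, 0)` is NOT group-like: `Φ(A_D) ≠ 0` ("for every `A ∈ Ob(D)`,
the homomorphism `B(A) → Φ^gp(A)` is nonzero"). [cite: MochizukiFrdII2008, Ex 1.1 (ii) p.8] -/
theorem not_isGroupLikeObj_zeroObj (A : D) :
    ¬ (ModelFrobenioid.data d.Φ d.B d.divB).IsGroupLikeObj (ModelFrobenioid.zeroObj d.Φ d.B d.divB A) := by
  intro h
  obtain ⟨x, hx⟩ := d.exists_ne_one (op A)
  exact hx (h x)

/-- Hence a `p`-adic Frobenioid admits a non-group-like object (the base `D` is connected, so nonempty) — the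
case "`C₁, C₂` admit non-group-like objects" of [FrdI] Thm. 3.4 (iii), p. 62.
[cite: MochizukiFrdII2008, Ex 1.1 (ii) p.8] -/
theorem exists_not_isGroupLikeObj :
    ∃ X : d.frobenioid, ¬ (ModelFrobenioid.data d.Φ d.B d.divB).IsGroupLikeObj X := by
  obtain ⟨A⟩ := d.isConnected_base.is_nonempty
  exact ⟨_, d.not_isGroupLikeObj_zeroObj A⟩

/-- A `p`-adic Frobenioid is not of group-like type (`Φ ≠ 0`; [FrdI] Thm. 5.2 (iii)).
[cite: MochizukiFrdII2008, Thm 1.2 (i) p.9] -/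
theorem not_isOfGroupLikeType : ¬ (ModelFrobenioid.data d.Φ d.B d.divB).IsOfGroupLikeType := fun hg =>
  d.not_isZeroMonoid ((ModelFrobenioid.data_isOfGroupLikeType_iff d.Φ d.B d.divB).mp hg)

end PadicFrd.Datum

namespace FrdI.Thm34Sub

variable {D₁ : Type u} [Category.{v} D₁] {D₂ : Type u} [Category.{v} D₂] {p₁ p₂ : ℕ} [Fact p₁.Prime]
  [Fact p₂.Prime] (d₁ : PadicFrd.Datum D₁ p₁) (d₂ : PadicFrd.Datum D₂ p₂)

/-- **`StdHyp` at `p`-adic Frobenioids** (the instance form of F-2692 the cone consumes, [IUTchI] Ex. 3.3 (iii)):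
for `p_i`-adic Frobenioids `C_i` over bases `D_i` of FSM-type and ANY equivalence `Ψ : C₁ ≌ C₂`, the hypotheses
(a)/(b) of [FrdI] Thm. 3.4 (iii)–(v) hold — `C_i` is a Frobenioid of standard type ([FrdII] Thm. 1.2 (i),
`thm12_isOfStandardType_of_isOfFSMType`, `isFrobenioid_of_isOfFSMType`) and (b) `HypB` is vacuous since `C₁` is
not of group-like type. [cite: MochizukiFrdII2008, Thm 1.2 (i) p.9] -/
theorem stdHyp_padic (hD₁ : IsOfFSMType D₁) (hD₂ : IsOfFSMType D₂) (Ψ : d₁.frobenioid ≌ d₂.frobenioid) :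
    StdHyp d₁.structureFunctor d₂.structureFunctor Ψ where
  isFrobenioid₁ := d₁.isFrobenioid_of_isOfFSMType hD₁
  isFrobenioid₂ := d₂.isFrobenioid_of_isOfFSMType hD₂
  fsm₁ := hD₁
  fsm₂ := hD₂
  standard₁ := d₁.thm12_isOfStandardType_of_isOfFSMType hD₁
  standard₂ := d₂.thm12_isOfStandardType_of_isOfFSMType hD₂
  hypB := fun hg _ => absurd hg d₁.not_isOfGroupLikeType

/-- **`FSMHyp` at `p`-adic Frobenioids** (the instance form of F-2691): two `p_i`-adic Frobenioids over bases of
FSM-type are Frobenioids of quasi-isotropic type with non-dilating `Φ_i` (standard type, [FrdII] Thm. 1.2 (i))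
admitting non-group-like objects (`exists_not_isGroupLikeObj`). [cite: MochizukiFrdII2008, Thm 1.2 (i) p.9] -/
theorem fsmHyp_padic (hD₁ : IsOfFSMType D₁) (hD₂ : IsOfFSMType D₂) :
    FSMHyp d₁.structureFunctor d₂.structureFunctor where
  isFrobenioid₁ := d₁.isFrobenioid_of_isOfFSMType hD₁
  isFrobenioid₂ := d₂.isFrobenioid_of_isOfFSMType hD₂
  quasiIsotropic₁ := (d₁.thm12_isOfStandardType_of_isOfFSMType hD₁).quasiIsotropic
  quasiIsotropic₂ := (d₂.thm12_isOfStandardType_of_isOfFSMType hD₂).quasiIsotropic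
  fsm₁ := hD₁
  fsm₂ := hD₂
  nonDilating₁ := (d₁.thm12_isOfStandardType_of_isOfFSMType hD₁).nonDilating
  nonDilating₂ := (d₂.thm12_isOfStandardType_of_isOfFSMType hD₂).nonDilating
  nonGroupLike₁ := d₁.exists_not_isGroupLikeObj
  nonGroupLike₂ := d₂.exists_not_isGroupLikeObj

/-- At a `p`-adic Frobenioid self-equivalence the Thm. 3.4 (iii) conclusions over FSM-type bases therefore hold
outright (`thm34iii_FSM_holds` fed with `fsmHyp_padic`): `Ψ` preserves the seven morphism classes and Frobenius
degrees. [cite: MochizukiFrdI2008, Thm. 3.4 (iii) p.62] -/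
theorem thm34iii_padic (hD₁ : IsOfFSMType D₁) (hD₂ : IsOfFSMType D₂) (Ψ : d₁.frobenioid ≌ d₂.frobenioid) :
    (PreservesMor Ψ.functor (ofFunctor d₁.Φ d₁.structureFunctor).IsFrobeniusType
        (ofFunctor d₂.Φ d₂.structureFunctor).IsFrobeniusType ∧
      PreservesMor Ψ.functor (ofFunctor d₁.Φ d₁.structureFunctor).IsLinear
        (ofFunctor d₂.Φ d₂.structureFunctor).IsLinear ∧
      PreservesMor Ψ.functor (ofFunctor d₁.Φ d₁.structureFunctor).IsBaseIso
        (ofFunctor d₂.Φ d₂.structureFunctor).IsBaseIso ∧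
      PreservesMor Ψ.functor (ofFunctor d₁.Φ d₁.structureFunctor).IsCoAngular
        (ofFunctor d₂.Φ d₂.structureFunctor).IsCoAngular ∧
      PreservesMor Ψ.functor (ofFunctor d₁.Φ d₁.structureFunctor).IsPullbackMorphism
        (ofFunctor d₂.Φ d₂.structureFunctor).IsPullbackMorphism ∧
      PreservesMor Ψ.functor (ofFunctor d₁.Φ d₁.structureFunctor).IsIsometry
        (ofFunctor d₂.Φ d₂.structureFunctor).IsIsometry ∧
      PreservesMor Ψ.functor (ofFunctor d₁.Φ d₁.structureFunctor).IsLBInvertible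
        (ofFunctor d₂.Φ d₂.structureFunctor).IsLBInvertible) ∧
    ∃ ΨN : ℕ+ ≃* ℕ+, (∀ ⦃A B : d₁.frobenioid⦄ (φ : A ⟶ B),
        (ofFunctor d₂.Φ d₂.structureFunctor).degFr (Ψ.functor.map φ) =
          ΨN ((ofFunctor d₁.Φ d₁.structureFunctor).degFr φ)) ∧ ΨN = MulEquiv.refl ℕ+ :=
  thm34iii_FSM_holds d₁.structureFunctor d₂.structureFunctor Ψ (fsmHyp_padic d₁ d₂ hD₁ hD₂)

end FrdI.Thm34Sub

end Literature.AlgebraicGeometry.Frobenioids
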